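import Summits.QuantumFields.YangMills.Theorems.BalabanUVNodesPortS1FEPolymerResummationHolds
import Summits.QuantumFields.YangMills.Theorems.BalabanUVNodesPortS1FEStepPieces
import Literature.Probability.LatticeModels.PolymerGasRatio

/-!
# PT-S1 ∕ ⟨27930⟩ — S₃ THROUGH THE EXPONENTIATION SEAM: the MULTIPLICATIVE polymer representation [II] (2.11) as the letter (`GasRepOnRegW`, S₃ᵐ `FEPolymerGasRepReg`),
# the seam (2.11) → (2.12) PROVED (`polymerRepOnRegW_of_gasRep`), and the four-piece glue re-cut on S₃ᵐ (`feStepReg_of_gasPieces`)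

Cell `ym-nodeO-ideate`, LENS IDEATOR 1 (◇ lens (i) = cluster-expansion ∕ polymer-gas remainder bounds), seat `ymgap-nodeO-lens-1` g19; memo sketch for NODE v30
(`nodeO-cover/LENS-1-NODE-v30.md`); candidate tree name `Theorems/BalabanUVNodesPortS1FEGasRep.lean` (porter's call; count-neutral here: 0 proposals).
[I] = [Balaban1987RG1], [II] = [Balaban1988RG2Cluster], [KP] = [KoteckyPreiss1986].

WHAT THIS FILE IS.  S₃ ✓`FEPolymerActivitiesReg` (`…PortS1FEStepPieces` :134, XXL, the wall) asks, on the ε₀-regular class, for the LOGARITHMIC identity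
`Φ(B) = log Ξ(B) − log Ξ(0)` (✓`PolymerRepOnRegW`, last conjunct) — print's (2.12), i.e. the polymer expansion ALREADY EXPONENTIATED.  Every cluster-expansion
technology (print's (2.4)–(2.9): conditioning, whitening `B′ = (C^{(k)})^{1/2}X`, s-localisation, product measure ⇒ (2.10) ⇒ (2.11); or any polymer engine of the tree,
e.g. lit `LocalPerturbationPolymerGas.pertZ_eq_polymerPartitionFunction`) DELIVERS the MULTIPLICATIVE statement (2.11) `∫dμ χ e^{…} = Ξ := Σ Π H(Zᵢ)`; the passage
(2.11) → (2.12) («if the activities … are sufficiently small, then the polymer expansion can be exponentiated according to the well-known formula», [II] p.14 L17–19)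
is Kotecký–Preiss under EXACTLY S₃'s own numerics (`A e^{5κ+1} K₀ 9·64 ≤ 1`, `κ + 2κ₀ + 2 ≤ R`, ✓`isKPVolume_torus_S4`) — and, because print's bracket
`recordFluctInt` is a REAL number (✓`feFluctDiff` is `((… : ℝ) : ℂ)`) and print's activities are real at real fields, the complex-logarithm branch never arises:
lit `polymerLogZ_eq_log_of_real` makes `log Ξ` the real logarithm of the positive `Re Ξ` (NODE v21 remark (n-1), now typed).
* §1 `GasRepOnRegW` — the Π-rep rows with the last conjunct replaced by (R) «activities real on the class» + (M) «`exp Φ(B) · Ξ(0) = Ξ(B)` on the class» ((2.11) at `B` and at `0`);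
* §2 ★★ `polymerRepOnRegW_of_gasRep` — (R)+(M) + S₄'s nesting ∕ `0`-regularity binders + the (2.41) numerics ⟹ ✓`PolymerRepOnRegW` (PROVED: KP ray zero-freeness
  lit `IsKPVolume.ray` + `polymerPartitionFunction_ne_zero_of_kp`, reality lit `polymerLogZ_eq_log_of_real` ∕ `polymerPartitionFunction_im_eq_zero`, `Real.log_mul`, `Real.log_exp`);
* §3 S₃ᵐ `FEPolymerGasRepReg F` — ✓`FEPolymerActivitiesReg` token for token with `GasRepOnRegW` for `PolymerRepOnRegW` (OPEN, XXL − the seam; inhabited nowhere; D-0026: not a fact);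
* §4 ★★ `feStepReg_of_gasPieces` — ✓`feStepReg_of_polymerPieces` re-cut: `P0C → S₁ → S₂ → S₃ᵐ → S₄ → FEStepReg` (PROVED; the seam sits where `hnest`∕`h0` are in scope).
HONEST FRAMING.  Bookkeeping + one Kotecký–Preiss∕real-analysis lemma over tree theorems; S₃ᵐ is NOT inhabited (the cluster expansion proper — [I] §3–§5, [II] §1, (2.1)–(2.11),
Lemma 3 (2.14)–(2.38) — is untouched and remains the wall); `stub_FEpolymerActivitiesReg` ∕ `stub_P0C` ∕ `stub_LZhalfReg` ∕ `stub_FEchartLawReg` ∕ `stub_regClassNestsUc` OPEN;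
⟨27930⟩ OPEN; K0⁷ stmt-QuantumFields-20541 OPEN; NODE O 0∕1; ladder counts UNMOVED; finite `𝕋⁴_{L^K}` at fixed ε — NOT continuum ∕ ℝ⁴ ∕ OS; **the Yang–Mills mass gap (Clay) is NOT
proved by any of this.**  No `sorry`, no `instance`, no `notation`, no new axioms.
-/

noncomputable section

open scoped BigOperators Matrix.Norms.L2Operator Topology

namespace Summit.QuantumFields.YangMills.Theorems.BalabanUVNodesPortS1

open Summit.QuantumFields.YangMills.Theorems.K0RecordFormatNames
open Literature.MathematicalPhysics.QuantumFieldTheory.Balaban1983to89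
open Literature.MathematicalPhysics.QuantumFieldTheory.Balaban1983to89.Node00
open Literature.MathematicalPhysics.QuantumFieldTheory.Balaban1983to89.T4Continuum (T4Family)
open Literature.MathematicalPhysics.QuantumFieldTheory.Balaban1983to89.TreeLengthTorusGeometry (TTouch ttouch_refl ttouch_symm)
open Literature.MathematicalPhysics.QuantumFieldTheory.Balaban1983to89.B12TreeDecay (kappa₀ K₀ K₀_pos kappa₀_nonneg)
open Literature.Probability.LatticeModels (IsKPVolume polymerLogZ polymerPartitionFunction polymerPartitionFunction_ne_zero_of_kp
  polymerPartitionFunction_im_eq_zero polymerLogZ_eq_log_of_real)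
open _root_.Filter

/-! ## §1  The multiplicative Π-rep rows (2.11) -/

open scoped Classical in
/-- ★ **GAS-rep ROWS — `exp Φ` IS A RATIO OF PARTITION FUNCTIONS OF A W-FORMAT POLYMER GAS WITH REAL ACTIVITIES ON THE ε₀-CLASS**: the hereditary activity rows
✓`ActivityRowsW … α₀ α₁ A R`, (1.7)-locality and (1.19)-invariance of the wrap activities (as in ✓`PolymerRepOnRegW`), and, for every ε₀-regular `B`:
(R) the activities `H(Z)` at the cut pairs of `B` are REAL (print: integrals of real integrands at real fields `(U_{k+1}(W_B), 0)`), and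
(M) `exp Φ(B) · Ξ(0) = Ξ(B)`, `Ξ(B) := Σ Π H(Zᵢ)` the hard-core partition function (2.11) («(2.1) = Σ H(Z₁)⋯H(Z_n)») — (2.12)'s exponentiation NOT yet performed.
A displayed rows-letter (the S₃ᵐ consequent's format); inhabited nowhere; a CANDIDATE letter (D-0026: not a fact; asserted for nothing).
[cite: Balaban1988RG2Cluster, (2.9)–(2.11) p.14; Balaban1987RG1, (2.13)–(2.14) p.268, (1.7) p.261, (1.18)–(1.19) p.263] -/
def GasRepOnRegW (F : T4Family) (Mc k : ℕ) (Hi : IntLocalFormula (F.L ^ (k + 1) * Mc)) (Hw : TorusPieces F Mc k)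
    (a₀ ε₂₉ α₀ α₁ ε₀ A R : ℝ) (Φf : (n : ℕ) → recordW F a₀ ε₂₉ k (recordK₀ F Mc k + n) → ℂ) : Prop :=
  ActivityRowsW F Mc k Hi Hw α₀ α₁ A R ∧ Hw.LocalOnW F ∧ Hw.GaugeInvOnW F ∧
    (∀ n (B : recordW F a₀ ε₂₉ k (recordK₀ F Mc k + n)), InRegClass F Mc k ε₀ a₀ ε₂₉ n B →
      ∀ Z : (recordDomSys F Mc k (recordK₀ F Mc k + n)).Dom, (fePolyAct F Mc k a₀ ε₂₉ Hi Hw n B Z).im = 0) ∧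
    ∀ n (B : recordW F a₀ ε₂₉ k (recordK₀ F Mc k + n)), InRegClass F Mc k ε₀ a₀ ε₂₉ n B →
      letI θ := thetaFill F a₀ ε₂₉; letI := θ.instVβ₁; letI := θ.instVβ₂; letI := θ.instιβ
      Complex.exp (Φf n B) * polymerPartitionFunction TTouch (fePolyAct F Mc k a₀ ε₂₉ Hi Hw n 0) Finset.univ =
        polymerPartitionFunction TTouch (fePolyAct F Mc k a₀ ε₂₉ Hi Hw n B) Finset.univ

/-! ## §2  ★★ The exponentiation seam (2.11) → (2.12), PROVED -/

open scoped Classical in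
/-- ★★ **THE EXPONENTIATION SEAM**: GAS-rep rows for a functional family `Φ` REAL on the ε₀-class, the (2.41) numerics of S₃∕S₄, the class nesting (`InRegClass ⟹ CutsInUc`)
and the ε₀-regularity of `B = 0` give the Π-rep rows ✓`PolymerRepOnRegW`: the gas at the cut pairs of a regular `B` (and of `0`) is a Kotecký–Preiss volume
(✓`isKPVolume_torus_S4` on ✓`norm_fePolyAct_le`), so every ray partition function is non-zero (lit `IsKPVolume.ray`, `polymerPartitionFunction_ne_zero_of_kp`); the
activities being real, `log Ξ = Real.log (Re Ξ)` with `Re Ξ > 0` (lit `polymerLogZ_eq_log_of_real`), and (M) read in real parts is `e^{Re Φ}·Re Ξ(0) = Re Ξ(B)`, whence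
`Φ = log Ξ(B) − log Ξ(0)` by `Real.log_mul` ∕ `Real.log_exp` — no branch of the complex logarithm is ever chosen.
[cite: Balaban1988RG2Cluster, (2.11)–(2.12) p.14 L17–19; KoteckyPreiss1986, Theorem p.492 (zero-freeness); Balaban1987RG1, (2.13)–(2.14) p.268] -/
theorem polymerRepOnRegW_of_gasRep {F : T4Family} {Mc k : ℕ} {Hi : IntLocalFormula (F.L ^ (k + 1) * Mc)} {Hw : TorusPieces F Mc k}
    {a₀ ε₂₉ α₀ α₁ ε₀ A R κ : ℝ} {Φf : (n : ℕ) → recordW F a₀ ε₂₉ k (recordK₀ F Mc k + n) → ℂ}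
    (hA : 0 ≤ A) (hκ : 4 * kappa₀ (4 * 2 ^ 4) (2 * 4) ≤ κ) (hR : κ + 2 * kappa₀ (4 * 2 ^ 4) (2 * 4) + 2 ≤ R)
    (hsm : A * Real.exp (5 * κ + 1) * K₀ (4 * 2 ^ 4) (2 * 4) * 9 * 64 ≤ 1)
    (hnest : ∀ n (B : recordW F a₀ ε₂₉ k (recordK₀ F Mc k + n)), InRegClass F Mc k ε₀ a₀ ε₂₉ n B → CutsInUc F Mc k α₀ α₁ a₀ ε₂₉ n B)
    (h0 : ∀ n, letI θ := thetaFill F a₀ ε₂₉; letI := θ.instVβ₁; letI := θ.instVβ₂; letI := θ.instιβ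
      InRegClass F Mc k ε₀ a₀ ε₂₉ n (0 : recordW F a₀ ε₂₉ k (recordK₀ F Mc k + n)))
    (hΦ : ∀ n (B : recordW F a₀ ε₂₉ k (recordK₀ F Mc k + n)), InRegClass F Mc k ε₀ a₀ ε₂₉ n B → (Φf n B).im = 0)
    (hgas : GasRepOnRegW F Mc k Hi Hw a₀ ε₂₉ α₀ α₁ ε₀ A R Φf) :
    PolymerRepOnRegW F Mc k Hi Hw a₀ ε₂₉ α₀ α₁ ε₀ A R Φf := by
  obtain ⟨hrows, hloc, hGI, hreal, hmult⟩ := hgas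
  refine ⟨hrows, hloc, hGI, fun n B hB => ?_⟩
  letI θ := thetaFill F a₀ ε₂₉; letI := θ.instVβ₁; letI := θ.instVβ₂; letI := θ.instιβ
  haveI : Std.Refl (TTouch (d := (F.P (recordK₀ F Mc k + n)).d) (N := Sect2.domCount (F.P (recordK₀ F Mc k + n)) Mc (k + 1))) := ⟨ttouch_refl⟩
  haveI : Std.Symm (TTouch (d := (F.P (recordK₀ F Mc k + n)).d) (N := Sect2.domCount (F.P (recordK₀ F Mc k + n)) Mc (k + 1))) := ⟨ttouch_symm⟩
  -- Kotecký–Preiss for the gas at the cut pairs of `B` and of `0`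
  have hKP := isKPVolume_torus_S4 (N := Sect2.domCount (F.P (recordK₀ F Mc k + n)) Mc (k + 1)) hA hκ hR hsm
    (norm_fePolyAct_le hrows (hnest n B hB))
  have hKP0 := isKPVolume_torus_S4 (N := Sect2.domCount (F.P (recordK₀ F Mc k + n)) Mc (k + 1)) hA hκ hR hsm
    (norm_fePolyAct_le hrows (hnest n _ (h0 n)))
  -- zero-freeness along the rays `t • H`, `t ∈ [0, 1]`
  have hrayB : ∀ t ∈ Set.Icc (0 : ℝ) 1,
      polymerPartitionFunction TTouch (fun γ => (t : ℂ) * fePolyAct F Mc k a₀ ε₂₉ Hi Hw n B γ) Finset.univ ≠ 0 :=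
    fun t ht => polymerPartitionFunction_ne_zero_of_kp (hKP.ray ht) (Finset.subset_univ _)
  have hray0 : ∀ t ∈ Set.Icc (0 : ℝ) 1,
      polymerPartitionFunction TTouch (fun γ => (t : ℂ) * fePolyAct F Mc k a₀ ε₂₉ Hi Hw n 0 γ) Finset.univ ≠ 0 :=
    fun t ht => polymerPartitionFunction_ne_zero_of_kp (hKP0.ray ht) (Finset.subset_univ _)
  -- real activities: `log Ξ` is the real logarithm of the positive `Re Ξ`, and `Ξ` is real
  obtain ⟨hposB, hlogB⟩ := polymerLogZ_eq_log_of_real (inc := TTouch) (hreal n B hB) hrayB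
  obtain ⟨hpos0, hlog0⟩ := polymerLogZ_eq_log_of_real (inc := TTouch) (hreal n _ (h0 n)) hray0
  have him0 := polymerPartitionFunction_im_eq_zero (inc := TTouch) (hreal n _ (h0 n)) Finset.univ
  -- (M) read in real parts: `e^{Re Φ} · Re Ξ(0) = Re Ξ(B)`
  have hM : Real.exp (Φf n B).re * (polymerPartitionFunction TTouch (fePolyAct F Mc k a₀ ε₂₉ Hi Hw n 0) Finset.univ).re =
      (polymerPartitionFunction TTouch (fePolyAct F Mc k a₀ ε₂₉ Hi Hw n B) Finset.univ).re := by
    have h := congrArg Complex.re (hmult n B hB)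
    simpa [Complex.mul_re, Complex.exp_re, Complex.exp_im, hΦ n B hB, him0] using h
  have hkey : (Φf n B).re = Real.log (polymerPartitionFunction TTouch (fePolyAct F Mc k a₀ ε₂₉ Hi Hw n B) Finset.univ).re -
      Real.log (polymerPartitionFunction TTouch (fePolyAct F Mc k a₀ ε₂₉ Hi Hw n 0) Finset.univ).re := by
    have h1 := congrArg Real.log hM
    rw [Real.log_mul (Real.exp_pos _).ne' hpos0.ne', Real.log_exp] at h1
    linarith
  have hΦre : Φf n B = (((Φf n B).re : ℝ) : ℂ) := Complex.ext (by simp) (by simp [hΦ n B hB])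
  -- conclusion
  unfold fePolyLogZ
  rw [hlogB, hlog0, hΦre, hkey, Complex.ofReal_sub]

/-! ## §3  S₃ᵐ — the cluster expansion proper with the MULTIPLICATIVE conclusion (OPEN, inhabited nowhere) -/

/-- ★★★ **S₃ᵐ `FEPolymerGasRepReg F` — THE CLUSTER EXPANSION PROPER, MULTIPLICATIVE EDITION (XXL − the seam)**: ✓`FEPolymerActivitiesReg` token for token, its conclusion
`PolymerRepOnRegW … (feFluctDiff …)` replaced by `GasRepOnRegW … (feFluctDiff …)` — [I] §3–§5 + [II] §1 + (2.1)–(2.11) + Lemma 3 (2.38), WITHOUT (2.12).  Implies S₃ only together with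
S₂'s nesting and the ε₀-regularity of `0` (§2), which is why the glue §4 — not a two-letter bridge — consumes it.  OPEN (XXL); inhabited nowhere; a CANDIDATE letter of the S₁–S₄ sub-split family (D-0026: not a fact;
asserted for nothing). [cite: Balaban1987RG1, §3–§5 pp.269–301, (2.13) p.268; Balaban1988RG2Cluster, (2.1)–(2.11) pp.11–14, (2.38) p.20] -/
def FEPolymerGasRepReg (F : T4Family) : Prop :=
  ∃ Mth : ℕ, ∀ Mc : ℕ, Mth ≤ Mc → ∀ (j c c₀ c₁ : ℕ) (B₃ B₃' a₀ a₁ : ℝ), Summit.QuantumFields.YangMills.Theorems.K0RecordFormatNames.McGuard F Mc → c ≤ F.L ^ j → c₀ ≤ j + 1 → c₁ ≤ j → 2 * (F.L : ℝ) ^ 2 ≤ B₃ → 0 < B₃' → 0 < a₀ → 0 < a₁ → Literature.MathematicalPhysics.QuantumFieldTheory.Balaban1983to89.Node00.VariationalThm1RegSepCoP7MGB F 2 (fun ν M g K k _s => c ≤ ν.M₁ ∧ k + c₀ ≤ F.m + K ∧ F.L ^ c₁ ∣ M ∧ ∀ i, 1 ≤ i → i ≤ k → Literature.MathematicalPhysics.QuantumFieldTheory.Balaban1983to89.Node00.dCubeSide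 (F.P K).L M (Literature.MathematicalPhysics.QuantumFieldTheory.Balaban1983to89.Node00.RkOfRecord (F.P K).L ν.r (g i)) i ∣ (F.P K).sitesPerDir 0) (Literature.MathematicalPhysics.QuantumFieldTheory.Balaban1983to89.Node00.lamDatum F) (Literature.MathematicalPhysics.QuantumFieldTheory.Balaban1983to89.Node00.dataSmall7LamTopOf F 2) B₃ a₀ a₁ → Literature.MathematicalPhysics.QuantumFieldTheory.Balaban1983to89.Node00.Gauge9RegSepTopStepGB F 2 (fun ν K Ω => Literature.MathematicalPhysics.QuantumFieldTheory.Balaban1983to89.Node00.suppDomOfRecord F ν K Ω) (F.L ^ j) (fun ν M g K k _s => c ≤ ν.M₁ ∧ k + c₀ ≤ F.m + K ∧ F.L ^ c₁ ∣ M ∧ ∀ i, 1 ≤ i → i ≤ k → Literature.MathematicalPhysics.QuantumFieldTheory.Balaban1983to89.Node00.dCubeSide (F.P K).L M (Literature.MathematicalPhysics.QuantumFieldTheory.Balaban1983to89.Node00.RkOfRecord (F.P K).L ν.r (g i)) i ∣ (F.P K).sitesPerDir 0) (Literature.MathematicalPhysics.QuantumFieldTheory.Balaban1983to89.Node00.lamDatum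 F) (Literature.MathematicalPhysics.QuantumFieldTheory.Balaban1983to89.Node00.dataSmall7LamTopOf F 2) B₃ B₃' a₀ a₁ → (∀ ε₁ : ℝ, 0 < ε₁ → ε₁ ≤ a₁ → B₃ * ε₁ ≤ a₀ → ∀ (k n : ℕ) (V : Literature.MathematicalPhysics.QuantumFieldTheory.Balaban1983to89.GaugeField (F.P (Summit.QuantumFields.YangMills.Theorems.K0RecordFormatNames.recordK₀ F Mc k + n)) (k + 1) (Literature.MathematicalPhysics.QuantumFieldTheory.Balaban1983to89.Node00.SU 2)), Literature.MathematicalPhysics.QuantumFieldTheory.Balaban1983to89.PlaqSmall ε₁ V → Literature.MathematicalPhysics.QuantumFieldTheory.Balaban1983to89.Node00.UkExists F 2 (Summit.QuantumFields.YangMills.Theorems.K0RecordFormatNames.recordK₀ F Mc k + n) (k + 1) a₀ V ∧ Literature.MathematicalPhysics.QuantumFieldTheory.Balaban1983to89.Node00.UniqueUkOrbit F 2 (Summit.QuantumFields.YangMills.Theorems.K0RecordFormatNames.recordK₀ F Mc k + n) (k + 1) a₀ V) → (∀ (k n : ℕ) (ε₂₉ : ℝ), 0 < ε₂₉ → letI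 θ := Summit.QuantumFields.YangMills.Theorems.K0RecordFormatNames.thetaFill F a₀ ε₂₉; letI := θ.instVβ₁; letI := θ.instVβ₂; letI := θ.instιβ; AnalyticAt ℝ (fun B : Summit.QuantumFields.YangMills.Theorems.K0RecordFormatNames.recordW F a₀ ε₂₉ k (Summit.QuantumFields.YangMills.Theorems.K0RecordFormatNames.recordK₀ F Mc k + n) => fun (b : Literature.MathematicalPhysics.QuantumFieldTheory.Balaban1983to89.PBond (F.P (Summit.QuantumFields.YangMills.Theorems.K0RecordFormatNames.recordK₀ F Mc k + n)) 0) (i i' : Fin 2) => ((Summit.QuantumFields.YangMills.Theorems.K0RecordFormatNames.recordBgField F θ k (Summit.QuantumFields.YangMills.Theorems.K0RecordFormatNames.recordK₀ F Mc k + n) B b : Literature.MathematicalPhysics.QuantumFieldTheory.Balaban1983to89.Node00.SU 2) : Matrix (Fin 2) (Fin 2) ℂ) i i') 0) → (∃ C₉' δ₉ : ℝ, 0 ≤ C₉' ∧ 0 < δ₉ ∧ ∀ (k n : ℕ) (ε₂₉ : ℝ), 0 < ε₂₉ → letI θ := Summit.QuantumFields.YangMills.Theorems.K0RecordFormatNames.thetaFill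 F a₀ ε₂₉; letI := θ.instVβ₁; letI := θ.instVβ₂; letI := θ.instιβ; ∀ (a : θ.ιβ) (μ : Fin (F.P (Summit.QuantumFields.YangMills.Theorems.K0RecordFormatNames.recordK₀ F Mc k + n)).d) (y : Literature.MathematicalPhysics.QuantumFieldTheory.Balaban1983to89.Site (F.P (Summit.QuantumFields.YangMills.Theorems.K0RecordFormatNames.recordK₀ F Mc k + n)) (k + 1)), letI D := fderiv ℝ (fun B : Summit.QuantumFields.YangMills.Theorems.K0RecordFormatNames.recordW F a₀ ε₂₉ k (Summit.QuantumFields.YangMills.Theorems.K0RecordFormatNames.recordK₀ F Mc k + n) => fun (b : Literature.MathematicalPhysics.QuantumFieldTheory.Balaban1983to89.PBond (F.P (Summit.QuantumFields.YangMills.Theorems.K0RecordFormatNames.recordK₀ F Mc k + n)) 0) (i i' : Fin 2) => ((Summit.QuantumFields.YangMills.Theorems.K0RecordFormatNames.recordBgField F θ k (Summit.QuantumFields.YangMills.Theorems.K0RecordFormatNames.recordK₀ F Mc k + n) B b : Literature.MathematicalPhysics.QuantumFieldTheory.Balaban1983to89.Node00.SU 2) : Matrix (Fin 2) (Fin 2)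 ℂ) i i') 0 (Pi.single μ (Pi.single y (θ.bV a))); ∃ (Hr : Literature.MathematicalPhysics.QuantumFieldTheory.Balaban1983to89.PBond (F.P (Summit.QuantumFields.YangMills.Theorems.K0RecordFormatNames.recordK₀ F Mc k + n)) 0 → Fin 2 → Fin 2 → ℂ) (φ : Literature.MathematicalPhysics.QuantumFieldTheory.Balaban1983to89.Site (F.P (Summit.QuantumFields.YangMills.Theorems.K0RecordFormatNames.recordK₀ F Mc k + n)) 0 → Fin 2 → Fin 2 → ℂ), (∀ b : Literature.MathematicalPhysics.QuantumFieldTheory.Balaban1983to89.PBond (F.P (Summit.QuantumFields.YangMills.Theorems.K0RecordFormatNames.recordK₀ F Mc k + n)) 0, D b = Hr b + (φ b.src - φ (b.src.shift b.dir))) ∧ (∃ μc : Literature.MathematicalPhysics.QuantumFieldTheory.Balaban1983to89.Site (F.P (Summit.QuantumFields.YangMills.Theorems.K0RecordFormatNames.recordK₀ F Mc k + n)) (k + 1) → Fin 2 → Fin 2 → ℂ, ∀ x : Literature.MathematicalPhysics.QuantumFieldTheory.Balaban1983to89.Site (F.P (Summit.QuantumFields.YangMills.Theorems.K0RecordFormatNames.recordK₀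 F Mc k + n)) 0, letI dv := (fun x' : Literature.MathematicalPhysics.QuantumFieldTheory.Balaban1983to89.Site (F.P (Summit.QuantumFields.YangMills.Theorems.K0RecordFormatNames.recordK₀ F Mc k + n)) 0 => ∑ ν : Fin (F.P (Summit.QuantumFields.YangMills.Theorems.K0RecordFormatNames.recordK₀ F Mc k + n)).d, (Hr ⟨x', ν⟩ - Hr ⟨x'.unshift ν, ν⟩)); ∑ ν : Fin (F.P (Summit.QuantumFields.YangMills.Theorems.K0RecordFormatNames.recordK₀ F Mc k + n)).d, (dv (x.shift ν) - (2 : ℂ) • dv x + dv (x.unshift ν)) = μc (Summit.QuantumFields.YangMills.Theorems.K0RecordFormatNames.coarsenTo (k + 1) x)) ∧ ∀ b : Literature.MathematicalPhysics.QuantumFieldTheory.Balaban1983to89.PBond (F.P (Summit.QuantumFields.YangMills.Theorems.K0RecordFormatNames.recordK₀ F Mc k + n)) 0, ‖Hr b‖ ≤ C₉' * (F.P (Summit.QuantumFields.YangMills.Theorems.K0RecordFormatNames.recordK₀ F Mc k + n)).eta (k + 1) * Real.exp (-(δ₉ * (Literature.MathematicalPhysics.QuantumFieldTheory.Balaban1983to89.Site.tdist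 (Summit.QuantumFields.YangMills.Theorems.K0RecordFormatNames.coarsenTo (k + 1) b.src) y : ℝ))) ∧ (∀ ν : Fin (F.P (Summit.QuantumFields.YangMills.Theorems.K0RecordFormatNames.recordK₀ F Mc k + n)).d, ‖Hr (⟨b.src.shift ν, b.dir⟩ : Literature.MathematicalPhysics.QuantumFieldTheory.Balaban1983to89.PBond (F.P (Summit.QuantumFields.YangMills.Theorems.K0RecordFormatNames.recordK₀ F Mc k + n)) 0) - Hr b‖ ≤ C₉' * (F.P (Summit.QuantumFields.YangMills.Theorems.K0RecordFormatNames.recordK₀ F Mc k + n)).eta (k + 1) ^ 2 * Real.exp (-(δ₉ * (Literature.MathematicalPhysics.QuantumFieldTheory.Balaban1983to89.Site.tdist (Summit.QuantumFields.YangMills.Theorems.K0RecordFormatNames.coarsenTo (k + 1) b.src) y : ℝ)))) ∧ ‖∑ ν : Fin (F.P (Summit.QuantumFields.YangMills.Theorems.K0RecordFormatNames.recordK₀ F Mc k + n)).d, (Hr (⟨b.src.shift ν, b.dir⟩ : Literature.MathematicalPhysics.QuantumFieldTheory.Balaban1983to89.PBond (F.P (Summit.QuantumFields.YangMills.Theorems.K0RecordFormatNames.recordK₀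 F Mc k + n)) 0) - (2 : ℂ) • Hr b + Hr (⟨b.src.unshift ν, b.dir⟩ : Literature.MathematicalPhysics.QuantumFieldTheory.Balaban1983to89.PBond (F.P (Summit.QuantumFields.YangMills.Theorems.K0RecordFormatNames.recordK₀ F Mc k + n)) 0))‖ ≤ C₉' * (F.P (Summit.QuantumFields.YangMills.Theorems.K0RecordFormatNames.recordK₀ F Mc k + n)).eta (k + 1) ^ 3 * Real.exp (-(δ₉ * (Literature.MathematicalPhysics.QuantumFieldTheory.Balaban1983to89.Site.tdist (Summit.QuantumFields.YangMills.Theorems.K0RecordFormatNames.coarsenTo (k + 1) b.src) y : ℝ))) ∧ ‖∑ ν : Fin (F.P (Summit.QuantumFields.YangMills.Theorems.K0RecordFormatNames.recordK₀ F Mc k + n)).d, ((Hr (⟨b.src, b.dir⟩ : Literature.MathematicalPhysics.QuantumFieldTheory.Balaban1983to89.PBond (F.P (Summit.QuantumFields.YangMills.Theorems.K0RecordFormatNames.recordK₀ F Mc k + n)) 0) + Hr (⟨(b.src).shift b.dir, ν⟩ : Literature.MathematicalPhysics.QuantumFieldTheory.Balaban1983to89.PBond (F.P (Summit.QuantumFields.YangMills.Theorems.K0RecordFormatNames.recordK₀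 F Mc k + n)) 0) - Hr (⟨(b.src).shift ν, b.dir⟩ : Literature.MathematicalPhysics.QuantumFieldTheory.Balaban1983to89.PBond (F.P (Summit.QuantumFields.YangMills.Theorems.K0RecordFormatNames.recordK₀ F Mc k + n)) 0) - Hr (⟨b.src, ν⟩ : Literature.MathematicalPhysics.QuantumFieldTheory.Balaban1983to89.PBond (F.P (Summit.QuantumFields.YangMills.Theorems.K0RecordFormatNames.recordK₀ F Mc k + n)) 0)) - (Hr (⟨b.src.unshift ν, b.dir⟩ : Literature.MathematicalPhysics.QuantumFieldTheory.Balaban1983to89.PBond (F.P (Summit.QuantumFields.YangMills.Theorems.K0RecordFormatNames.recordK₀ F Mc k + n)) 0) + Hr (⟨(b.src.unshift ν).shift b.dir, ν⟩ : Literature.MathematicalPhysics.QuantumFieldTheory.Balaban1983to89.PBond (F.P (Summit.QuantumFields.YangMills.Theorems.K0RecordFormatNames.recordK₀ F Mc k + n)) 0) - Hr (⟨(b.src.unshift ν).shift ν, b.dir⟩ : Literature.MathematicalPhysics.QuantumFieldTheory.Balaban1983to89.PBond (F.P (Summit.QuantumFields.YangMills.Theorems.K0RecordFormatNames.recordK₀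 F Mc k + n)) 0) - Hr (⟨b.src.unshift ν, ν⟩ : Literature.MathematicalPhysics.QuantumFieldTheory.Balaban1983to89.PBond (F.P (Summit.QuantumFields.YangMills.Theorems.K0RecordFormatNames.recordK₀ F Mc k + n)) 0)))‖ ≤ C₉' * (F.P (Summit.QuantumFields.YangMills.Theorems.K0RecordFormatNames.recordK₀ F Mc k + n)).eta (k + 1) ^ 3 * Real.exp (-(δ₉ * (Literature.MathematicalPhysics.QuantumFieldTheory.Balaban1983to89.Site.tdist (Summit.QuantumFields.YangMills.Theorems.K0RecordFormatNames.coarsenTo (k + 1) b.src) y : ℝ)))) → ∀ εp : ℝ, 0 < εp → ∃ ε₂₉ : ℝ, 0 < ε₂₉ ∧ ε₂₉ ≤ εp ∧ ∀ (E₁ κ₁ β₀ β₁ δ₀ : ℝ), 0 ≤ E₁ → 4 * Literature.MathematicalPhysics.QuantumFieldTheory.Balaban1983to89.B12TreeDecay.kappa₀ (4 * 2 ^ 4) (2 * 4) ≤ κ₁ → 0 < β₀ → 0 < β₁ → 0 < δ₀ → (∀ k : ℕ, Summit.QuantumFields.YangMills.Theorems.BalabanUVNodesPortS1.LZResidueRegAt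 F Mc a₀ ε₂₉ β₀ β₁ δ₀ E₁ κ₁ k) → ∃ α₀ α₁ : ℝ, 0 < α₀ ∧ 0 < α₁ ∧ ∀ εcap : ℝ, 0 < εcap → ∃ γ₀ ε₀ A R E₂ κ : ℝ, 0 < γ₀ ∧ 0 < ε₀ ∧ ε₀ ≤ εcap ∧ 0 ≤ A ∧ 0 ≤ E₂ ∧ 4 * Literature.MathematicalPhysics.QuantumFieldTheory.Balaban1983to89.B12TreeDecay.kappa₀ (4 * 2 ^ 4) (2 * 4) ≤ κ ∧ κ + 2 * Literature.MathematicalPhysics.QuantumFieldTheory.Balaban1983to89.B12TreeDecay.kappa₀ (4 * 2 ^ 4) (2 * 4) + 2 ≤ R ∧ A * Real.exp (5 * κ + 1) * Literature.MathematicalPhysics.QuantumFieldTheory.Balaban1983to89.B12TreeDecay.K₀ (4 * 2 ^ 4) (2 * 4) * 9 * 64 ≤ 1 ∧ 2 * (Real.exp 1 * 9 * 64 * Literature.MathematicalPhysics.QuantumFieldTheory.Balaban1983to89.B12TreeDecay.K₀ (4 * 2 ^ 4) (2 * 4) ^ 2 * A) ≤ E₂ ∧ ∀ k : ℕ, (∀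 j : ℕ, j < k → Summit.QuantumFields.YangMills.Theorems.BalabanUVNodesPortS1.FEResidueRegBoxAt F Mc a₀ ε₂₉ γ₀ α₀ α₁ ε₀ E₂ κ j) → ∀ v : Fin (k + 1) → ℝ, v ∈ Literature.MathematicalPhysics.QuantumFieldTheory.Balaban1983to89.FlowStep.Box γ₀ k → ∃ (Hi : Summit.QuantumFields.YangMills.Theorems.K0RecordFormatNames.IntLocalFormula (F.L ^ (k + 1) * Mc)) (Hw : Summit.QuantumFields.YangMills.Theorems.K0RecordFormatNames.TorusPieces F Mc k), Summit.QuantumFields.YangMills.Theorems.BalabanUVNodesPortS1.GasRepOnRegW F Mc k Hi Hw a₀ ε₂₉ α₀ α₁ ε₀ A R (Summit.QuantumFields.YangMills.Theorems.BalabanUVNodesPortS1.feFluctDiff F Mc a₀ ε₂₉ k v)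

/-! ## §4  ★★ The four-piece glue re-cut on S₃ᵐ (PROVED) -/

/-- ★★ **`P0C → S₁ → S₂ → S₃ᵐ → S₄ → FEStepReg`** — ✓`feStepReg_of_polymerPieces` with S₃ᵐ for S₃: the exponentiation seam ★★`polymerRepOnRegW_of_gasRep` is applied at the one place
where the nesting `hnest` and the regularity `h0` of `0` are in scope; the bracket ✓`feFluctDiff` is real by construction.  Bookkeeping over §2.
[cite: Balaban1987RG1, (2.10)–(2.14) pp.267–268; Balaban1988RG2Cluster, (2.11)–(2.13) p.14] -/
theorem feStepReg_of_gasPieces (hP0C : ∀ F, P0HolExtAtRecordGL F) (hS₁ : ∀ F, FEChartLawReg F) (hS₂ : ∀ F, RegClassNestsUc F)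
    (hS₃ : ∀ F, FEPolymerGasRepReg F) (hS₄ : ∀ F, FEPolymerResummation F) : ∀ F, FEStepReg F := by
  intro F
  obtain ⟨M₁, H₁⟩ := hS₁ F
  obtain ⟨M₂, H₂⟩ := hS₂ F
  obtain ⟨M₃, H₃⟩ := hS₃ F
  refine ⟨max (max M₁ M₂) M₃, fun Mc hMc j c c₀ c₁ B₃ B₃' a₀ a₁ hG h₁ h₂ h₃ h₄ h₅ h₆ h₇ hT8 hT9 hTE hP9 hP9L => ?_⟩
  have hM₁ : M₁ ≤ Mc := le_trans (le_max_left _ _) (le_of_max_le_left hMc)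
  have hM₂ : M₂ ≤ Mc := le_trans (le_max_right _ _) (le_of_max_le_left hMc)
  have hM₃ : M₃ ≤ Mc := le_of_max_le_right hMc
  obtain ⟨εp, hεp, HC⟩ := H₁ Mc hM₁ j c c₀ c₁ B₃ B₃' a₀ a₁ hG h₁ h₂ h₃ h₄ h₅ h₆ h₇ hT8 hT9 hTE hP9 hP9L (hP0C F)
  have HN := H₂ Mc hM₂ j c c₀ c₁ B₃ B₃' a₀ a₁ hG h₁ h₂ h₃ h₄ h₅ h₆ h₇ hT8 hT9 hTE hP9 hP9L
  obtain ⟨ε₂₉, hε, hεle, HA⟩ := H₃ Mc hM₃ j c c₀ c₁ B₃ B₃' a₀ a₁ hG h₁ h₂ h₃ h₄ h₅ h₆ h₇ hT8 hT9 hTE hP9 hP9L εp hεp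
  obtain ⟨εc, hεc, HC'⟩ := HC ε₂₉ hε hεle
  refine ⟨ε₂₉, hε, fun E₁ κ₁ β₀ β₁ δ₀ hE₁ hκ₁ hβ₀ hβ₁ hδ₀ HLZ => ?_⟩
  obtain ⟨α₀, α₁, hα₀, hα₁, HA'⟩ := HA E₁ κ₁ β₀ β₁ δ₀ hE₁ hκ₁ hβ₀ hβ₁ hδ₀ HLZ
  obtain ⟨εn, hεn, HN'⟩ := HN ε₂₉ α₀ α₁ hε hα₀ hα₁
  obtain ⟨γ₀, ε₀, A, R, E₂, κ, hγ, hε₀, hε₀le, hA, hE₂, hκ, hR, hsm, hAE, Hstep⟩ := HA' (min εc εn) (lt_min hεc hεn)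
  -- the antecedent's [15] Thm 1 token at the admissible radius `ε₁ := min a₁ (a₀ ∕ B₃)` (as in ✓`portRecordFEHalfBox_of_reg`)
  have hL1 : (1 : ℝ) ≤ (F.L : ℝ) := by exact_mod_cast F.hL.2.le
  have hB₃ : 0 < B₃ := lt_of_lt_of_le (by positivity : (0 : ℝ) < 2 * (F.L : ℝ) ^ 2) h₄
  have hε₁ : 0 < min a₁ (a₀ / B₃) := lt_min h₇ (div_pos h₆ hB₃)
  have hUk := hTE (min a₁ (a₀ / B₃)) hε₁ (min_le_left _ _)
    (by rw [← le_div_iff₀' hB₃]; exact min_le_right _ _)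
  refine ⟨γ₀, E₂, κ, α₀, α₁, ε₀, hγ, hE₂, hκ, hα₀, hα₁, hε₀, fun k ih v hv => ?_⟩
  obtain ⟨Hi, Hw, hgas⟩ := Hstep k ih v hv
  have hnest : ∀ n (B : recordW F a₀ ε₂₉ k (recordK₀ F Mc k + n)), InRegClass F Mc k ε₀ a₀ ε₂₉ n B → CutsInUc F Mc k α₀ α₁ a₀ ε₂₉ n B :=
    fun n B hB => HN' ε₀ hε₀ (le_trans hε₀le (min_le_right _ _)) k n B hB
  have h0 : ∀ n, letI θ := thetaFill F a₀ ε₂₉; letI := θ.instVβ₁; letI := θ.instVβ₂; letI := θ.instιβ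
      InRegClass F Mc k ε₀ a₀ ε₂₉ n (0 : recordW F a₀ ε₂₉ k (recordK₀ F Mc k + n)) :=
    fun n => by
      letI θ := thetaFill F a₀ ε₂₉; letI := θ.instVβ₁; letI := θ.instVβ₂; letI := θ.instιβ
      exact (eventually_inRegClass F a₀ ε₂₉ Mc k n (hP9 k n ε₂₉ hε) hε₁ (hUk k n) hε₀).self_of_nhds
  -- ★ THE EXPONENTIATION SEAM (A3): the multiplicative (2.11) rows give S₃'s logarithmic Π-rep rows, the bracket being real (`Complex.ofReal_im`)
  have hrep : PolymerRepOnRegW F Mc k Hi Hw a₀ ε₂₉ α₀ α₁ ε₀ A R (feFluctDiff F Mc a₀ ε₂₉ k v) :=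
    polymerRepOnRegW_of_gasRep hA hκ hR hsm hnest h0 (fun n B _ => by simp [feFluctDiff]) hgas
  obtain ⟨Ψ, Ew, hres⟩ := hS₄ F Mc k a₀ ε₂₉ α₀ α₁ ε₀ A R E₂ κ Hi Hw (feFluctDiff F Mc a₀ ε₂₉ k v) hG hA hκ hR hsm hAE hnest h0 hrep
  have hid : ∀ n (B : recordW F a₀ ε₂₉ k (recordK₀ F Mc k + n)), InRegClass F Mc k ε₀ a₀ ε₂₉ n B →
      phiFE F Mc a₀ ε₂₉ k v n B = feFluctDiff F Mc a₀ ε₂₉ k v n B :=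
    HC' E₁ κ₁ β₀ β₁ δ₀ hE₁ hκ₁ hβ₀ hβ₁ hδ₀ HLZ γ₀ E₂ κ α₀ α₁ ε₀ hγ hE₂ hκ hα₀ hα₁ hε₀ (le_trans hε₀le (min_le_left _ _)) k ih v hv
  exact ⟨Ψ, Ew, hres.1, hres.2.1, hres.2.2.1, hres.2.2.2.1, hres.2.2.2.2.1, hres.2.2.2.2.2.1,
    fun n B hB => (hid n B hB).trans (hres.2.2.2.2.2.2 n B hB)⟩



end Summit.QuantumFields.YangMills.Theorems.BalabanUVNodesPortS1

end
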